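import Literature.AlgebraicGeometry.Motives.AbelianVarietyDihedralOrderEightBrauerRelations
import Literature.GroupTheory.SpecificGroups.AlternatingDegreeFourSubgroups
import Mathlib.GroupTheory.SpecificGroups.Alternating
import HarnessLib

/-!
# The Brauer relation lattice of the alternating group `A_4` in full: `K(A_4) = ℤΘ ⊕ ℤΘ_ind` with
# Bartel–Dokchitser's PRIMITIVE relation `Θ = C_2 − C_3 − V_4 + A_4` (Theorem A, case (3)(a), `G = 𝔽_2² ⋊ C_3`,
# `Prim(A_4) ≅ ℤ`) and the relation `Θ_ind = 1 − 3C_2 + 2V_4` induced from the Klein four-group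

Layer A1/A2 of the Hodge foundations lane (`lit-hodgefound`, row A1-20⁺ · A2, seat p03 generation 28, row g28-#9) on
the ALGEBRAIC carrier; sequel of `Motives/AbelianVarietyDihedralOrderEightBrauerRelations` (g28-#2; same method —
the permutation characters of a system of representatives as explicit functions, then the lattice; CONSUMED:
`indClassFun_one_apply_eq_div`, `card_conj_mem_bot`, `indClassFun_top_one`, `mem_ker_linearCombination_indClassFun_one_iff`)
and companion of `Motives/AbelianVarietyTetrahedralIdempotentRelations` (the Kani–Rosen isogenies of the two
generators, in group form for every tetrahedral `G = V ⋊ ⟨σ⟩`: **`isIsogenous_tetrahedral_trigonal`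
(`B_τ × B_G ∼ B_V × B_σ`, the isogeny of `Θ`) and `isIsogenous_tetrahedral_involution` (`X × B_V² ∼ B_τ³`, the
isogeny of `Θ_ind`)** — CITED, not restated).  Bartel–Dokchitser, Theorem A (3): a soluble `G ≅ 𝔽_l^d ⋊ Q` with
`𝔽_l^d` a faithful irreducible representation of the quasi-elementary group `Q` has `Prim(G) ≅ ℤ` if `Q` is cyclic,
with basis (for `d > 1`) `Θ = G − Q + Σ_U (U ⋊ N_Q U − 𝔽_l^d ⋊ N_Q U)`, "sum over `U ⊂ 𝔽_l^d` of index `l` up to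
`G`-conjugacy"; Example 4: "`A_4`, which is of type 3(a) in Theorem A with `Q` cyclic".  For `A_4 = 𝔽_2² ⋊ C_3`
(`l = 2`, `d = 2`, `Q = C_3`): the three `U` of index `2` in `V_4 = 𝔽_2²` are permuted transitively by `C_3`, so
`N_Q U = 1` and **`Θ = A_4 − C_3 + (C_2 − V_4) = C_2 − C_3 − V_4 + A_4`**.  Here on Mathlib's
`alternatingGroup (Fin 4)` (`τ = (0 1)(2 3)`, `σ = (0 1 2) = swap 0 1 * swap 1 2`, `V_4 = C_{A_4}(τ)`): the five
classes of subgroups `1, C_2 = ⟨τ⟩, C_3 = ⟨σ⟩, V_4, A_4`, their permutation characters (§2, marks by `decide`), the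
class equations (§3: **`a ∈ K(A_4)` iff `a_1 = −a_{C_2} − a_V`, `a_{C_3} = 2a_{C_2} + 3a_V`, `a_G = −2a_{C_2} − 3a_V`**),
hence **`rank K(A_4) = 2`** (the non-cyclic classes `V_4, A_4`) with basis `Θ, Θ_ind`; the imprimitive part is
`ℤΘ_ind` (the only non-cyclic proper subquotients are `V_4 ≅ C_2 × C_2` and its images), and **no non-zero multiple
of `Θ` lies in it: `Prim(A_4) = K(A_4)/ℤΘ_ind ≅ ℤ`, generated by `Θ`** (§4).  Everything here is PROVED; NO
definition, NO named fact (net Literature debt 0).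

## Sources, verbatim

A. Bartel, T. Dokchitser, *Brauer relations in finite groups*, J. Eur. Math. Soc. **17** (2015) (arXiv 1103.2047, held
`paper:arxiv-1103.2047`).  Theorem A (p0003): "(3) `G` is an extension `1 → S^d → G → Q → 1`, where `S` is simple,
`Q` is quasi-elementary, the natural map `Q → Out S^d` is injective and, moreover, either (a) `S^d` is minimal among
the normal subgroups of `G` (for soluble `G`, this is equivalent to `G ≅ 𝔽_l^d ⋊ Q` with `𝔽_l^d` a faithful
irreducible representation of `Q`) […]"; table, case 3a: "`Prim(G) = ℤ` if `Q` cyclic, `ℤ/pℤ` else"; basis for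
`G ≅ 𝔽_l^d ⋊ Q` soluble: "`Θ = G − Q + Σ_U (U ⋊ N_Q U − 𝔽_l^d ⋊ N_Q U)` if `d > 1`; sum over `U ⊂ 𝔽_l^d` of index `l`
up to `G`-conjugacy".  §8 Example 4 (p0022): "The only other subquotient of `G` [= `SL_2(𝔽_3)`] that has primitive
relations is `G/Z(G) ≅ A_4`, which is of type 3(a) in Theorem A with `Q` cyclic."  §2 (p0006): "the rank of `K(G)`
is the number of conjugacy classes of non-cyclic subgroups"; Induction; Example 3 (`C_p × C_p`: `Θ = 1 − Σ_C C + pG`).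
H. Lange, R. E. Rodríguez, LNM 2310 (2022), §5.5.1 (p. 128): "`A_4 = ⟨(12)(34), (123)⟩ = ⟨τ, σ⟩` […] all subgroups of
order two, as well as all subgroups of order three, are conjugate among themselves"; (5.39):
`ρ_⟨τ⟩ ⊕ ρ_{A₄} = ρ_K ⊕ ρ_⟨σ⟩`.

## Dictionary and what is proved (namespace `Literature.AlgebraicGeometry.Motives.AbelianVariety`)

Representatives `![1, C_2, C_3, V_4, A_4] = ![⊥, zpowers τ, zpowers σ, centralizer {τ}, ⊤]`; classes described by
`g = 1`, `(g : Perm (Fin 4))² = 1` (the identity and the three double transpositions), `(g : Perm (Fin 4))³ = 1`;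
`Θ = ![0, 1, -1, -1, 1]`, `Θ_ind = ![1, -3, 0, 2, 0]`; `𝒦` any `Submodule ℤ (Fin 5 → ℤ)` with
`a ∈ 𝒦 ↔ Σ_i a_i (1_{H_i})^G = 0`.

* §1 `card_alternatingFour`, `mem_klein_alternatingFour_iff` (`x ∈ C_{A_4}(τ) ↔ x² = 1`: the centraliser of `τ` IS the
  Klein four-group), `natCard_subgroups_alternatingFour`, **`centralizer_tau_eq_kleinFour_alternatingFour`**
  (`C_{A_4}(τ) = alternatingGroup.kleinFour (Fin 4)`, via the tree's `AlternatingDegreeFour.alternatingGroup_klein_eq_kleinFour`;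
  the model lemmas `alternatingGroup_orderOf_tau/_sigma/_mul` of `GroupTheory/SpecificGroups/AlternatingDegreeFourSubgroups`
  are CONSUMED, not restated).
* §2 `card_conj_mem_tau/_sigma/_klein_alternatingFour`, **`indClassFun_one_apply_alternatingFour`**.
* §3 `sq_eq_one_or_cube_eq_one_alternatingFour`, `sum_smul_indClassFun_alternatingFour_apply`,
  **`sum_smul_indClassFun_alternatingFour_eq_zero_iff`**, **`thetaPrim_mem_alternatingFour`**,
  `thetaInd_mem_alternatingFour`, `indClassFun_tau_add_top_eq_alternatingFour` (the `2 + 2` form, LR (5.39)).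
* §4 `mem_brauerRelations_alternatingFour_iff`, **`eq_combination_of_mem_brauerRelations_alternatingFour`**,
  **`brauerRelations_alternatingFour_eq_span`**, `linearIndependent_basis_alternatingFour`,
  **`smul_thetaPrim_mem_span_thetaInd_iff`** (`kΘ ∈ ℤΘ_ind ↔ k = 0`: `Prim(A_4) ≅ ℤ`),
  `ker_linearCombination_indClassFun_one_alternatingFour_eq_span`,
  **`finrank_ker_linearCombination_indClassFun_one_alternatingFour`** (`= 2`).

Scope (stated, not hidden): `A_4` only (the smallest instance of case (3)(a), `l = 2`, `d = 2`, `Q = C_3`); the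
identification of `Θ_ind` as "induced from `V_4`" and of `ℤΘ_ind` as the whole imprimitive part is by the
subquotient bookkeeping in words (`A_4/V_4 ≅ C_3` and all proper subgroups other than `V_4` cyclic — `K = 0` there),
not by a Lean `Prim` functor.

## References

* [BartelDokchitser2015] A. Bartel, T. Dokchitser, *Brauer relations in finite groups*, JEMS 17 (2015), §1.1 Theorem A
  (3)(a) and its table, §2, §8 Example 4.
* [LangeRodriguez2022] H. Lange, R. E. Rodríguez, *Decomposition of Jacobians by Prym varieties*, LNM 2310, §5.5.1,
  (5.39).
-/

noncomputable section

universe u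

open CategoryTheory CategoryTheory.Limits
open Literature.RepresentationTheory.FiniteGroups
open Literature.GroupTheory.SpecificGroups
open Equiv Equiv.Perm

namespace Literature.AlgebraicGeometry.Motives

namespace AbelianVariety

/-! ## §1 `A_4 = alternatingGroup (Fin 4)`: `τ = (0 1)(2 3)`, `σ = (0 1 2)`, `V_4 = C_{A_4}(τ)` -/

section AlternatingFourGroup

/-- `|A_4| = 12`. [cite: LangeRodriguez2022, §5.5.1 ("the alternating group 𝒜₄ of order 12")] -/
theorem card_alternatingFour : Fintype.card (alternatingGroup (Fin 4)) = 12 := by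
  decide

/-- `x ∈ ⟨τ⟩ ↔ x ∈ {τ^k : k < 2}`. [folklore] -/
private theorem mem_zpowers_tau_alternatingFour_iff (x : alternatingGroup (Fin 4)) :
    x ∈ Subgroup.zpowers (⟨swap 0 1 * swap 2 3, mem_alternatingGroup.2 (by decide)⟩ : alternatingGroup (Fin 4)) ↔ x ∈ (Finset.range 2).image ((⟨swap 0 1 * swap 2 3, mem_alternatingGroup.2 (by decide)⟩ : alternatingGroup (Fin 4)) ^ ·) := by
  rw [mem_zpowers_iff_mem_range_orderOf, AlternatingDegreeFour.alternatingGroup_orderOf_tau]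

/-- `x ∈ ⟨σ⟩ ↔ x ∈ {σ^k : k < 3}`. [folklore] -/
private theorem mem_zpowers_sigma_alternatingFour_iff (x : alternatingGroup (Fin 4)) :
    x ∈ Subgroup.zpowers (⟨swap 0 1 * swap 1 2, mem_alternatingGroup.2 (by decide)⟩ : alternatingGroup (Fin 4)) ↔ x ∈ (Finset.range 3).image ((⟨swap 0 1 * swap 1 2, mem_alternatingGroup.2 (by decide)⟩ : alternatingGroup (Fin 4)) ^ ·) := by
  rw [mem_zpowers_iff_mem_range_orderOf, AlternatingDegreeFour.alternatingGroup_orderOf_sigma]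

/-- **The centraliser of `τ` in `A_4` is the Klein four-group `V_4 = {1, (01)(23), (02)(13), (03)(12)}`**:
`x ∈ C_{A_4}(τ) ↔ x² = 1`. [cite: LangeRodriguez2022, §5.5.1 ("K denote the Klein subgroup of order 4 of 𝒜₄")] [cite: BartelDokchitser2015, §1.1 Theorem A (3)(a) ("𝔽_l^d")] -/
theorem mem_klein_alternatingFour_iff (x : alternatingGroup (Fin 4)) :
    x ∈ Subgroup.centralizer ({(⟨swap 0 1 * swap 2 3, mem_alternatingGroup.2 (by decide)⟩ : alternatingGroup (Fin 4))} : Set (alternatingGroup (Fin 4))) ↔ (x : Perm (Fin 4)) ^ 2 = 1 := by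
  rw [Subgroup.mem_centralizer_iff]
  simp only [Set.mem_singleton_iff, forall_eq]
  revert x
  decide

end AlternatingFourGroup

/-! ## §2 The marks and permutation characters of `C_2, C_3, V_4`, machine-checked -/

section AlternatingFourMarks

/-- `|{x : Q x}|` as a filter cardinality. [folklore] -/
private theorem natCard_subtype_eq_card_filter_a4 (P : alternatingGroup (Fin 4) → Prop) [DecidablePred P]
    (Q : alternatingGroup (Fin 4) → Prop) (hQP : ∀ x, Q x ↔ P x) :
    Nat.card {x : alternatingGroup (Fin 4) // Q x} = (Finset.univ.filter P).card := by
  rw [← Fintype.card_subtype, ← Nat.card_eq_fintype_card]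
  exact Nat.card_congr (Equiv.subtypeEquivRight hQP)

/-- **Marks of `C_2 = ⟨τ⟩`**: `12` at `1`, `4` on the double transpositions, `0` on the `3`-cycles. [cite: LangeRodriguez2022, §5.5.1 ("all subgroups of order two … are conjugate")] -/
theorem card_conj_mem_tau_alternatingFour (g : alternatingGroup (Fin 4)) :
    Nat.card {x : alternatingGroup (Fin 4) // x⁻¹ * g * x ∈ Subgroup.zpowers (⟨swap 0 1 * swap 2 3, mem_alternatingGroup.2 (by decide)⟩ : alternatingGroup (Fin 4))} =
      if g = 1 then 12 else if (g : Perm (Fin 4)) ^ 2 = 1 then 4 else 0 := by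
  classical
  rw [natCard_subtype_eq_card_filter_a4 _ _ fun x ↦ mem_zpowers_tau_alternatingFour_iff _]
  revert g
  decide

/-- **Marks of `C_3 = ⟨σ⟩`**: `12` at `1`, `3` on the `3`-cycles (`σ` and `σ⁻¹` are not `A_4`-conjugate), `0` on
`V_4 ∖ 1`. [cite: LangeRodriguez2022, §5.5.1 ("all subgroups of order three, are conjugate")] -/
theorem card_conj_mem_sigma_alternatingFour (g : alternatingGroup (Fin 4)) :
    Nat.card {x : alternatingGroup (Fin 4) // x⁻¹ * g * x ∈ Subgroup.zpowers (⟨swap 0 1 * swap 1 2, mem_alternatingGroup.2 (by decide)⟩ : alternatingGroup (Fin 4))} =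
      if g = 1 then 12 else if (g : Perm (Fin 4)) ^ 3 = 1 then 3 else 0 := by
  classical
  rw [natCard_subtype_eq_card_filter_a4 _ _ fun x ↦ mem_zpowers_sigma_alternatingFour_iff _]
  revert g
  decide

/-- **Marks of `V_4 ⊴ A_4`**: `12·[g ∈ V_4]`. [cite: LangeRodriguez2022, §5.5.1 ("the Klein subgroup")] -/
theorem card_conj_mem_klein_alternatingFour (g : alternatingGroup (Fin 4)) :
    Nat.card {x : alternatingGroup (Fin 4) // x⁻¹ * g * x ∈ Subgroup.centralizer ({(⟨swap 0 1 * swap 2 3, mem_alternatingGroup.2 (by decide)⟩ : alternatingGroup (Fin 4))} : Set (alternatingGroup (Fin 4)))} =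
      if (g : Perm (Fin 4)) ^ 2 = 1 then 12 else 0 := by
  classical
  rw [natCard_subtype_eq_card_filter_a4 _ _ fun x ↦ mem_klein_alternatingFour_iff _]
  revert g
  decide +kernel

/-- The orders `2, 3, 4` of `C_2, C_3, V_4`. [cite: LangeRodriguez2022, §5.5.1 (diagram (5.38): degrees 2, 3, 4)] -/
theorem natCard_subgroups_alternatingFour :
    Nat.card (Subgroup.zpowers (⟨swap 0 1 * swap 2 3, mem_alternatingGroup.2 (by decide)⟩ : alternatingGroup (Fin 4))) = 2 ∧ Nat.card (Subgroup.zpowers (⟨swap 0 1 * swap 1 2, mem_alternatingGroup.2 (by decide)⟩ : alternatingGroup (Fin 4))) = 3 ∧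
      Nat.card ↥(Subgroup.centralizer ({(⟨swap 0 1 * swap 2 3, mem_alternatingGroup.2 (by decide)⟩ : alternatingGroup (Fin 4))} : Set (alternatingGroup (Fin 4)))) = 4 := by
  classical
  refine ⟨?_, ?_, ?_⟩
  · rw [Nat.card_zpowers, AlternatingDegreeFour.alternatingGroup_orderOf_tau]
  · rw [Nat.card_zpowers, AlternatingDegreeFour.alternatingGroup_orderOf_sigma]
  · show Nat.card {x : alternatingGroup (Fin 4) // x ∈ Subgroup.centralizer ({(⟨swap 0 1 * swap 2 3, mem_alternatingGroup.2 (by decide)⟩ : alternatingGroup (Fin 4))} : Set (alternatingGroup (Fin 4)))} = 4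
    rw [natCard_subtype_eq_card_filter_a4 (fun x ↦ (x : Perm (Fin 4)) ^ 2 = 1) (· ∈ Subgroup.centralizer ({(⟨swap 0 1 * swap 2 3, mem_alternatingGroup.2 (by decide)⟩ : alternatingGroup (Fin 4))} : Set (alternatingGroup (Fin 4))))
      mem_klein_alternatingFour_iff]
    decide

/-- **`V_4 = C_{A_4}(τ)` IS the tree's `K = ⟨τ⟩ ⊔ ⟨στσ⁻¹⟩` and Mathlib's `alternatingGroup.kleinFour (Fin 4)`**
(`⟨τ⟩ ⊔ ⟨στσ⁻¹⟩ ≤ C(τ)`, both of order `4`; then `AlternatingDegreeFour.alternatingGroup_klein_eq_kleinFour`).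
[cite: LangeRodriguez2022, §5.5.1 ("K denote the Klein subgroup of order 4 of 𝒜₄")] -/
theorem centralizer_tau_eq_kleinFour_alternatingFour :
    Subgroup.centralizer ({(⟨swap 0 1 * swap 2 3, mem_alternatingGroup.2 (by decide)⟩ : alternatingGroup (Fin 4))} : Set (alternatingGroup (Fin 4))) = alternatingGroup.kleinFour (Fin 4) := by
  rw [← AlternatingDegreeFour.alternatingGroup_klein_eq_kleinFour]
  symm
  refine Subgroup.eq_of_le_of_card_ge (sup_le (Subgroup.zpowers_le.2 ?_) (Subgroup.zpowers_le.2 ?_)) ?_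
  · rw [mem_klein_alternatingFour_iff]
    decide
  · rw [mem_klein_alternatingFour_iff]
    decide
  · rw [natCard_subgroups_alternatingFour.2.2,
      AlternatingDegreeFour.card_klein AlternatingDegreeFour.alternatingGroup_orderOf_sigma
        AlternatingDegreeFour.alternatingGroup_orderOf_tau AlternatingDegreeFour.alternatingGroup_orderOf_mul]

/-- **The five permutation characters of `A_4` as explicit functions**: `(1_1)^G = 12δ_1`; `(1_{C_2})^G`: `6, 2, 0`;
`(1_{C_3})^G`: `4, 0, 1`; `(1_{V_4})^G = 3·1_{V_4}`; `(1_{A_4})^G = 1` (values at `1`, double transpositions,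
`3`-cycles). [cite: BartelDokchitser2015, §1.1 ("Θ ∈ K(G) ⟺ Σ_i n_i Ind 1_{H_i} = 0")] [cite: LangeRodriguez2022, §5.5.1 (5.39)] -/
theorem indClassFun_one_apply_alternatingFour (g : alternatingGroup (Fin 4)) :
    indClassFun (⊥ : Subgroup (alternatingGroup (Fin 4))) 1 g = (if g = 1 then (12 : ℂ) else 0) ∧
    indClassFun (Subgroup.zpowers (⟨swap 0 1 * swap 2 3, mem_alternatingGroup.2 (by decide)⟩ : alternatingGroup (Fin 4))) 1 g =
      (if g = 1 then (6 : ℂ) else if (g : Perm (Fin 4)) ^ 2 = 1 then 2 else 0) ∧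
    indClassFun (Subgroup.zpowers (⟨swap 0 1 * swap 1 2, mem_alternatingGroup.2 (by decide)⟩ : alternatingGroup (Fin 4))) 1 g =
      (if g = 1 then (4 : ℂ) else if (g : Perm (Fin 4)) ^ 3 = 1 then 1 else 0) ∧
    indClassFun (Subgroup.centralizer ({(⟨swap 0 1 * swap 2 3, mem_alternatingGroup.2 (by decide)⟩ : alternatingGroup (Fin 4))} : Set (alternatingGroup (Fin 4)))) 1 g =
      (if (g : Perm (Fin 4)) ^ 2 = 1 then (3 : ℂ) else 0) ∧
    indClassFun (⊤ : Subgroup (alternatingGroup (Fin 4))) 1 g = 1 := by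
  classical
  obtain ⟨c1, c2, c3⟩ := natCard_subgroups_alternatingFour
  refine ⟨?_, ?_, ?_, ?_, ?_⟩
  · rw [indClassFun_one_apply_eq_div, card_conj_mem_bot, Subgroup.card_bot, card_alternatingFour]
    split_ifs <;> norm_num
  · rw [indClassFun_one_apply_eq_div, card_conj_mem_tau_alternatingFour, c1]
    split_ifs <;> norm_num
  · rw [indClassFun_one_apply_eq_div, card_conj_mem_sigma_alternatingFour, c2]
    split_ifs <;> norm_num
  · rw [indClassFun_one_apply_eq_div, card_conj_mem_klein_alternatingFour, c3]
    split_ifs <;> norm_num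
  · rw [indClassFun_top_one, Pi.one_apply]

end AlternatingFourMarks

/-! ## §3 The class equations; `Θ` and `Θ_ind` -/

section AlternatingFourRelations

/-- The three classes up to rational conjugacy: every `g ∈ A_4` is `1`, a double transposition (`g² = 1`, `g ≠ 1`),
or a `3`-cycle (`g³ = 1`, `g² ≠ 1`), machine-checked. [cite: LangeRodriguez2022, §5.5.1] -/
theorem sq_eq_one_or_cube_eq_one_alternatingFour (g : alternatingGroup (Fin 4)) :
    g = 1 ∨ ((g : Perm (Fin 4)) ^ 2 = 1 ∧ g ≠ 1 ∧ (g : Perm (Fin 4)) ^ 3 ≠ 1) ∨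
      ((g : Perm (Fin 4)) ^ 3 = 1 ∧ g ≠ 1 ∧ (g : Perm (Fin 4)) ^ 2 ≠ 1) := by
  revert g
  decide

/-- At `g = 1` both class predicates hold. [folklore] -/
private theorem one_sq_cube_alternatingFour :
    ((1 : alternatingGroup (Fin 4)) : Perm (Fin 4)) ^ 2 = 1 ∧ ((1 : alternatingGroup (Fin 4)) : Perm (Fin 4)) ^ 3 = 1 := by
  decide

/-- The signed-sum test on `![1, C_2, C_3, V_4, A_4]`, pointwise. [cite: BartelDokchitser2015, §1.1] -/
theorem sum_smul_indClassFun_alternatingFour_apply (a : Fin 5 → ℤ) (g : alternatingGroup (Fin 4)) :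
    (∑ i : Fin 5, (a i : ℂ) • indClassFun ((![⊥,
        Subgroup.zpowers (⟨swap 0 1 * swap 2 3, mem_alternatingGroup.2 (by decide)⟩ : alternatingGroup (Fin 4)),
        Subgroup.zpowers (⟨swap 0 1 * swap 1 2, mem_alternatingGroup.2 (by decide)⟩ : alternatingGroup (Fin 4)),
        Subgroup.centralizer ({(⟨swap 0 1 * swap 2 3, mem_alternatingGroup.2 (by decide)⟩ : alternatingGroup (Fin 4))} : Set (alternatingGroup (Fin 4))),
        ⊤] :
        Fin 5 → Subgroup (alternatingGroup (Fin 4))) i) 1) g =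
      a 0 * (if g = 1 then (12 : ℂ) else 0) + a 1 * (if g = 1 then (6 : ℂ) else if (g : Perm (Fin 4)) ^ 2 = 1 then 2 else 0) +
        a 2 * (if g = 1 then (4 : ℂ) else if (g : Perm (Fin 4)) ^ 3 = 1 then 1 else 0) + a 3 * (if (g : Perm (Fin 4)) ^ 2 = 1 then (3 : ℂ) else 0) + a 4 := by
  obtain ⟨h0, h1, h2, h3, h4⟩ := indClassFun_one_apply_alternatingFour g
  simp only [Finset.sum_apply, Pi.smul_apply, smul_eq_mul, Fin.sum_univ_five]
  show (a 0 : ℂ) * indClassFun (⊥ : Subgroup (alternatingGroup (Fin 4))) 1 g +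
      (a 1 : ℂ) * indClassFun (Subgroup.zpowers (⟨swap 0 1 * swap 2 3, mem_alternatingGroup.2 (by decide)⟩ : alternatingGroup (Fin 4))) 1 g +
      (a 2 : ℂ) * indClassFun (Subgroup.zpowers (⟨swap 0 1 * swap 1 2, mem_alternatingGroup.2 (by decide)⟩ : alternatingGroup (Fin 4))) 1 g +
      (a 3 : ℂ) * indClassFun (Subgroup.centralizer ({(⟨swap 0 1 * swap 2 3, mem_alternatingGroup.2 (by decide)⟩ : alternatingGroup (Fin 4))} : Set (alternatingGroup (Fin 4)))) 1 g +
      (a 4 : ℂ) * indClassFun (⊤ : Subgroup (alternatingGroup (Fin 4))) 1 g = _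
  rw [h0, h1, h2, h3, h4, mul_one]

/-- **The Brauer relations of `A_4`**: `a ∈ K(A_4)` iff `a_1 = −a_{C_2} − a_V`, `a_{C_3} = 2a_{C_2} + 3a_V`,
`a_G = −2a_{C_2} − 3a_V` (free `a_{C_2}, a_V`: rank `2` = the non-cyclic classes `V_4, A_4`) — the class equations at
`1`, `τ`, `σ` solved. [cite: BartelDokchitser2015, §1.1; §2 ("the rank of K(G) is the number of conjugacy classes of non-cyclic subgroups")] -/
theorem sum_smul_indClassFun_alternatingFour_eq_zero_iff (a : Fin 5 → ℤ) :
    ∑ i : Fin 5, (a i : ℂ) • indClassFun ((![⊥,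
        Subgroup.zpowers (⟨swap 0 1 * swap 2 3, mem_alternatingGroup.2 (by decide)⟩ : alternatingGroup (Fin 4)),
        Subgroup.zpowers (⟨swap 0 1 * swap 1 2, mem_alternatingGroup.2 (by decide)⟩ : alternatingGroup (Fin 4)),
        Subgroup.centralizer ({(⟨swap 0 1 * swap 2 3, mem_alternatingGroup.2 (by decide)⟩ : alternatingGroup (Fin 4))} : Set (alternatingGroup (Fin 4))),
        ⊤] :
        Fin 5 → Subgroup (alternatingGroup (Fin 4))) i) 1 = 0 ↔
      a 0 = -a 1 - a 3 ∧ a 2 = 2 * a 1 + 3 * a 3 ∧ a 4 = -2 * a 1 - 3 * a 3 := by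
  constructor
  · intro h
    have e := fun g ↦ (sum_smul_indClassFun_alternatingFour_apply a g).symm.trans (congr_fun h g)
    have e0 := e 1
    have e1 := e (⟨swap 0 1 * swap 2 3, mem_alternatingGroup.2 (by decide)⟩ : alternatingGroup (Fin 4))
    have e2 := e (⟨swap 0 1 * swap 1 2, mem_alternatingGroup.2 (by decide)⟩ : alternatingGroup (Fin 4))
    simp (config := { decide := true }) only [Pi.zero_apply, if_true, if_false, mul_zero, add_zero] at e0 e1 e2
    have i0 : ((12 * a 0 + 6 * a 1 + 4 * a 2 + 3 * a 3 + a 4 : ℤ) : ℂ) = 0 := by push_cast; linear_combination e0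
    have i1 : ((2 * a 1 + 3 * a 3 + a 4 : ℤ) : ℂ) = 0 := by push_cast; linear_combination e1
    have i2 : ((a 2 + a 4 : ℤ) : ℂ) = 0 := by push_cast; linear_combination e2
    norm_cast at i0 i1 i2
    omega
  · rintro ⟨h0, h2, h4⟩
    funext g
    rw [sum_smul_indClassFun_alternatingFour_apply, Pi.zero_apply, h0, h2, h4]
    push_cast
    rcases sq_eq_one_or_cube_eq_one_alternatingFour g with rfl | ⟨hg2, hg1, hg3⟩ | ⟨hg3, hg1, hg2⟩
    · simp only [if_true, if_pos one_sq_cube_alternatingFour.1, if_pos one_sq_cube_alternatingFour.2]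
      ring
    · simp only [if_neg hg1, if_pos hg2, if_neg hg3]
      ring
    · simp only [if_neg hg1, if_neg hg2, if_pos hg3]
      ring

/-- **Bartel–Dokchitser's primitive relation of `A_4`: `Θ = C_2 − C_3 − V_4 + A_4` is a relation** (Theorem A
(3)(a): `Θ = G − Q + Σ_U (U ⋊ N_Q U − 𝔽_l^d ⋊ N_Q U)` with `Q = C_3`, `N_Q U = 1`).
[cite: BartelDokchitser2015, §1.1 Theorem A (3)(a) (table: "Θ = G − Q + Σ_U (U ⋊ N_Q U − 𝔽_l^d ⋊ N_Q U) if d > 1"); §8 Example 4 ("A_4, which is of type 3(a)")] -/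
theorem thetaPrim_mem_alternatingFour :
    ∑ i : Fin 5, (((![0, 1, -1, -1, 1] : Fin 5 → ℤ) i : ℤ) : ℂ) • indClassFun ((![⊥,
        Subgroup.zpowers (⟨swap 0 1 * swap 2 3, mem_alternatingGroup.2 (by decide)⟩ : alternatingGroup (Fin 4)),
        Subgroup.zpowers (⟨swap 0 1 * swap 1 2, mem_alternatingGroup.2 (by decide)⟩ : alternatingGroup (Fin 4)),
        Subgroup.centralizer ({(⟨swap 0 1 * swap 2 3, mem_alternatingGroup.2 (by decide)⟩ : alternatingGroup (Fin 4))} : Set (alternatingGroup (Fin 4))),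
        ⊤] :
        Fin 5 → Subgroup (alternatingGroup (Fin 4))) i) 1 = 0 :=
  (sum_smul_indClassFun_alternatingFour_eq_zero_iff _).2 (by simp)

/-- **`Θ_ind = 1 − 3C_2 + 2V_4`, Example 3's `1 − Σ_C C + 2V_4` INDUCED from the Klein four-group** (its three
`C`'s being `A_4`-conjugate), is a relation. [cite: BartelDokchitser2015, §2 (Induction; Example 3)] [cite: LangeRodriguez2022, §5.5.1 (5.39)] -/
theorem thetaInd_mem_alternatingFour :
    ∑ i : Fin 5, (((![1, -3, 0, 2, 0] : Fin 5 → ℤ) i : ℤ) : ℂ) • indClassFun ((![⊥,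
        Subgroup.zpowers (⟨swap 0 1 * swap 2 3, mem_alternatingGroup.2 (by decide)⟩ : alternatingGroup (Fin 4)),
        Subgroup.zpowers (⟨swap 0 1 * swap 1 2, mem_alternatingGroup.2 (by decide)⟩ : alternatingGroup (Fin 4)),
        Subgroup.centralizer ({(⟨swap 0 1 * swap 2 3, mem_alternatingGroup.2 (by decide)⟩ : alternatingGroup (Fin 4))} : Set (alternatingGroup (Fin 4))),
        ⊤] :
        Fin 5 → Subgroup (alternatingGroup (Fin 4))) i) 1 = 0 :=
  (sum_smul_indClassFun_alternatingFour_eq_zero_iff _).2 (by simp)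

/-- **`(1_{C_2})^G + (1_{A_4})^G = (1_{C_3})^G + (1_{V_4})^G`** — `Θ` as a two-plus-two identity of permutation
characters (`ρ_⟨τ⟩ ⊕ ρ_{A₄} = ρ_K ⊕ ρ_⟨σ⟩`; its Kani–Rosen isogeny `B_τ × B_{A_4} ∼ B_σ × B_{V_4}` is the tree's
`isIsogenous_tetrahedral_trigonal`). [cite: LangeRodriguez2022, §5.5.1 (5.39)] [cite: BartelDokchitser2015, §1.1 Theorem A (3)(a)] -/
theorem indClassFun_tau_add_top_eq_alternatingFour :
    indClassFun (Subgroup.zpowers (⟨swap 0 1 * swap 2 3, mem_alternatingGroup.2 (by decide)⟩ : alternatingGroup (Fin 4))) 1 + indClassFun (⊤ : Subgroup (alternatingGroup (Fin 4))) 1 =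
      indClassFun (Subgroup.zpowers (⟨swap 0 1 * swap 1 2, mem_alternatingGroup.2 (by decide)⟩ : alternatingGroup (Fin 4))) 1 + indClassFun (Subgroup.centralizer ({(⟨swap 0 1 * swap 2 3, mem_alternatingGroup.2 (by decide)⟩ : alternatingGroup (Fin 4))} : Set (alternatingGroup (Fin 4)))) 1 := by
  funext g
  obtain ⟨-, h1, h2, h3, h4⟩ := indClassFun_one_apply_alternatingFour g
  simp only [Pi.add_apply]
  rw [h1, h2, h3, h4]
  rcases sq_eq_one_or_cube_eq_one_alternatingFour g with rfl | ⟨hg2, hg1, hg3⟩ | ⟨hg3, hg1, hg2⟩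
  · simp only [if_true, if_pos one_sq_cube_alternatingFour.1, if_pos one_sq_cube_alternatingFour.2]
    norm_num
  · simp only [if_neg hg1, if_pos hg2, if_neg hg3]
    norm_num
  · simp only [if_neg hg1, if_neg hg2, if_pos hg3]
    norm_num

end AlternatingFourRelations

/-! ## §4 `K(A_4) = ℤΘ ⊕ ℤΘ_ind`, `Prim(A_4) ≅ ℤ` -/

section AlternatingFourLattice

variable (𝒦 : Submodule ℤ (Fin 5 → ℤ))
  (h𝒦 : ∀ a : Fin 5 → ℤ, a ∈ 𝒦 ↔ ∑ i : Fin 5, (a i : ℂ) • indClassFun ((![⊥,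
        Subgroup.zpowers (⟨swap 0 1 * swap 2 3, mem_alternatingGroup.2 (by decide)⟩ : alternatingGroup (Fin 4)),
        Subgroup.zpowers (⟨swap 0 1 * swap 1 2, mem_alternatingGroup.2 (by decide)⟩ : alternatingGroup (Fin 4)),
        Subgroup.centralizer ({(⟨swap 0 1 * swap 2 3, mem_alternatingGroup.2 (by decide)⟩ : alternatingGroup (Fin 4))} : Set (alternatingGroup (Fin 4))),
        ⊤] :
        Fin 5 → Subgroup (alternatingGroup (Fin 4))) i) 1 = 0)
include h𝒦

/-- **Membership in `K(A_4)` in coordinates.** [cite: BartelDokchitser2015, §1.1; §2] -/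
theorem mem_brauerRelations_alternatingFour_iff (a : Fin 5 → ℤ) :
    a ∈ 𝒦 ↔ a 0 = -a 1 - a 3 ∧ a 2 = 2 * a 1 + 3 * a 3 ∧ a 4 = -2 * a 1 - 3 * a 3 :=
  (h𝒦 a).trans (sum_smul_indClassFun_alternatingFour_eq_zero_iff a)

/-- `Θ, Θ_ind ∈ K(A_4)`. [cite: BartelDokchitser2015, §1.1 Theorem A (3)(a); §2] -/
theorem generators_mem_brauerRelations_alternatingFour :
    (![0, 1, -1, -1, 1] : Fin 5 → ℤ) ∈ 𝒦 ∧ (![1, -3, 0, 2, 0] : Fin 5 → ℤ) ∈ 𝒦 :=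
  ⟨(h𝒦 _).2 thetaPrim_mem_alternatingFour, (h𝒦 _).2 thetaInd_mem_alternatingFour⟩

/-- **Every relation of `A_4` is `(−2a_{C_2} − 3a_V)·Θ + (−a_{C_2} − a_V)·Θ_ind`.** [cite: BartelDokchitser2015, §1.1 Theorem A (3)(a) ("Prim(G) = ℤ if Q cyclic")] -/
theorem eq_combination_of_mem_brauerRelations_alternatingFour {a : Fin 5 → ℤ} (ha : a ∈ 𝒦) :
    a = (-2 * a 1 - 3 * a 3) • (![0, 1, -1, -1, 1] : Fin 5 → ℤ) + (-a 1 - a 3) • (![1, -3, 0, 2, 0] : Fin 5 → ℤ) := by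
  obtain ⟨h0, h2, h4⟩ := (mem_brauerRelations_alternatingFour_iff 𝒦 h𝒦 a).1 ha
  funext i
  fin_cases i <;> simp <;> omega

/-- **`K(A_4) = ℤΘ ⊕ ℤΘ_ind`.** [cite: BartelDokchitser2015, §1.1 Theorem A (3)(a); §2] -/
theorem brauerRelations_alternatingFour_eq_span :
    𝒦 = Submodule.span ℤ {(![0, 1, -1, -1, 1] : Fin 5 → ℤ), ![1, -3, 0, 2, 0]} := by
  obtain ⟨m1, m2⟩ := generators_mem_brauerRelations_alternatingFour 𝒦 h𝒦
  refine le_antisymm (fun a ha ↦ ?_) (Submodule.span_le.2 ?_)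
  · rw [eq_combination_of_mem_brauerRelations_alternatingFour 𝒦 h𝒦 ha]
    exact Submodule.add_mem _ (Submodule.smul_mem _ _ (Submodule.subset_span (by simp)))
      (Submodule.smul_mem _ _ (Submodule.subset_span (by simp)))
  · rintro v (rfl | rfl)
    exacts [m1, m2]

omit h𝒦 in
/-- `Θ, Θ_ind` are linearly independent. [cite: BartelDokchitser2015, §2 ("clearly linearly independent")] -/
theorem linearIndependent_basis_alternatingFour :
    LinearIndependent ℤ (![(![0, 1, -1, -1, 1] : Fin 5 → ℤ), ![1, -3, 0, 2, 0]] : Fin 2 → Fin 5 → ℤ) := by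
  rw [Fintype.linearIndependent_iff]
  intro c hc i
  have e0 := congr_fun hc 0
  have e4 := congr_fun hc 4
  simp [Fin.sum_univ_two] at e0 e4
  fin_cases i <;> simp <;> omega

omit h𝒦 in
/-- **`Prim(A_4) ≅ ℤ`, generated by `Θ`**: no non-zero multiple of `Θ` lies in the imprimitive part `ℤΘ_ind`
(`kΘ ∈ ℤΘ_ind ↔ k = 0`; with `K(A_4) = ℤΘ ⊕ ℤΘ_ind` the quotient `K(A_4)/ℤΘ_ind` is infinite cyclic on the class of
`Θ`). [cite: BartelDokchitser2015, §1.1 Theorem A (3)(a) ("Prim(G) = ℤ if Q cyclic"); §8 Example 4] -/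
theorem smul_thetaPrim_mem_span_thetaInd_iff (k : ℤ) :
    k • (![0, 1, -1, -1, 1] : Fin 5 → ℤ) ∈ Submodule.span ℤ {(![1, -3, 0, 2, 0] : Fin 5 → ℤ)} ↔ k = 0 := by
  constructor
  · intro h
    rw [Submodule.mem_span_singleton] at h
    obtain ⟨m, hm⟩ := h
    have e4 := congr_fun hm 4
    simp at e4
    omega
  · rintro rfl
    rw [zero_smul]
    exact Submodule.zero_mem _

omit h𝒦 in
/-- The canonical lattice `K(A_4) = ker(a ↦ Σ_i a_i (1_{H_i})^G) = ℤΘ ⊕ ℤΘ_ind`. [cite: BartelDokchitser2015, §1.1 Theorem A (3)(a)] -/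
theorem ker_linearCombination_indClassFun_one_alternatingFour_eq_span :
    LinearMap.ker (Fintype.linearCombination ℤ fun i : Fin 5 ↦ indClassFun ((![⊥,
        Subgroup.zpowers (⟨swap 0 1 * swap 2 3, mem_alternatingGroup.2 (by decide)⟩ : alternatingGroup (Fin 4)),
        Subgroup.zpowers (⟨swap 0 1 * swap 1 2, mem_alternatingGroup.2 (by decide)⟩ : alternatingGroup (Fin 4)),
        Subgroup.centralizer ({(⟨swap 0 1 * swap 2 3, mem_alternatingGroup.2 (by decide)⟩ : alternatingGroup (Fin 4))} : Set (alternatingGroup (Fin 4))),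
        ⊤] :
        Fin 5 → Subgroup (alternatingGroup (Fin 4))) i) 1) =
      Submodule.span ℤ {(![0, 1, -1, -1, 1] : Fin 5 → ℤ), ![1, -3, 0, 2, 0]} :=
  brauerRelations_alternatingFour_eq_span _ (mem_ker_linearCombination_indClassFun_one_iff _)

omit h𝒦 in
/-- **`rank K(A_4) = 2`** (on the canonical lattice) — the non-cyclic classes `V_4, A_4`. [cite: BartelDokchitser2015, §2] -/
theorem finrank_ker_linearCombination_indClassFun_one_alternatingFour :
    Module.finrank ℤ (LinearMap.ker (Fintype.linearCombination ℤ fun i : Fin 5 ↦ indClassFun ((![⊥,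
        Subgroup.zpowers (⟨swap 0 1 * swap 2 3, mem_alternatingGroup.2 (by decide)⟩ : alternatingGroup (Fin 4)),
        Subgroup.zpowers (⟨swap 0 1 * swap 1 2, mem_alternatingGroup.2 (by decide)⟩ : alternatingGroup (Fin 4)),
        Subgroup.centralizer ({(⟨swap 0 1 * swap 2 3, mem_alternatingGroup.2 (by decide)⟩ : alternatingGroup (Fin 4))} : Set (alternatingGroup (Fin 4))),
        ⊤] :
        Fin 5 → Subgroup (alternatingGroup (Fin 4))) i) 1)) = 2 := by
  rw [ker_linearCombination_indClassFun_one_alternatingFour_eq_span]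
  have h := linearIndependent_basis_alternatingFour
  rw [show ({(![0, 1, -1, -1, 1] : Fin 5 → ℤ), ![1, -3, 0, 2, 0]} : Set (Fin 5 → ℤ)) =
      Set.range (![(![0, 1, -1, -1, 1] : Fin 5 → ℤ), ![1, -3, 0, 2, 0]] : Fin 2 → Fin 5 → ℤ) by
    ext v
    simp only [Set.mem_insert_iff, Set.mem_singleton_iff, Set.mem_range]
    constructor
    · rintro (rfl | rfl)
      exacts [⟨0, rfl⟩, ⟨1, rfl⟩]
    · rintro ⟨i, rfl⟩
      fin_cases i <;> simp]
  rw [finrank_span_eq_card h, Fintype.card_fin]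

end AlternatingFourLattice

end AbelianVariety

end Literature.AlgebraicGeometry.Motives
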